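import Literature.MathematicalPhysics.QuantumLattice.XYOrderInfraredProofs
import HarnessLib

/-!
# Translation invariance of the thermal correlations of the Heisenberg model on the torus

Sibling proof file of `Literature/MathematicalPhysics/QuantumLattice/HeisenbergOrder.lean`
(item `provefact-Literature.MathematicalPhysics.QuantumLattice.spinSpinCorrTorus_add_right`),
the thermal companion of `HeisenbergOrderTranslationProofs.lean` (the ground-state case,
`groundStateSpinCorrTorus_add_right_holds`, with the translation invariance
`heisenbergTorus_submatrix_comp_addRight` of the torus Hamiltonian); the two files are independent
(both rest on the site-relabelling bookkeeping of `XYOrderInfraredProofs.lean`). No statement is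
introduced or changed; this file discharges the named fact

* `spinSpinCorrTorus_add_right_holds : spinSpinCorrTorus_add_right` — translation invariance
  `⟨𝐒_{x+v} · 𝐒_{y+v}⟩_{β,L} = ⟨𝐒_x · 𝐒_y⟩_{β,L}` of the thermal two-point function
  `spinSpinCorrTorus β L n J` of the spin-`n/2` Heisenberg model `H_L = J Σ_{⟨x,y⟩} 𝐒_x · 𝐒_y` on
  the discrete torus `(ℤ/Lℤ)^d` (periodic boundary conditions), for all `β`, `L`, `n`, `J`, `v`,
  `x`, `y` — Dyson–Lieb–Simon (1978) §1, pp. 337–339, where the Hamiltonian (2) is taken with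
  periodic boundary conditions ("`Λ`, viewed as a torus") and the two-point function of the Gibbs
  state (3Qb) enters through its translation averages `g_p = ⟨Ŝ_p · Ŝ_{-p}⟩` (8), with the sum
  rule (9)/(9Q) valid at "any value of `α`" — i.e. translation invariance,

and records, as reusable API, the covariance of the Heisenberg Hamiltonian of an arbitrary finite
graph under graph automorphisms (`heisenbergHamiltonian_submatrix_comp`; torus translations —
the public statement is `heisenbergTorus_submatrix_comp_addRight` of
`HeisenbergOrderTranslationProofs.lean`, re-derived here privately from the general lemma — and
torus reflections are special cases) and the resulting symmetry of the torus Gibbs state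
(`gibbsState_heisenbergTorus_submatrix_comp_addRight`).

## The argument (folklore; Bratteli–Robinson II §6.2.1 covariance, §5.3.1 Gibbs states)

The translation `π = (· + v)` of the torus is a bijection of the sites; on tensor indices it acts
by `σ ↦ σ ∘ π`, i.e. by the permutation matrix `U` of `e = (σ ↦ σ ∘ π)`, and relabelling is
conjugation, `U M Uᴴ = M ∘ (e × e)` (`Matrix.toPEquiv_toMatrix_conj`). Relabelling sends
`S^α_x ↦ S^α_{x+v}` (`siteSpin_submatrix_comp`) and fixes `H_L`, because `π` is a graph
automorphism of the nearest-neighbour torus graph (`heisenbergHamiltonian_submatrix_comp`: the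
edge sum is reindexed along `Sym2.map π`). A unitary commuting with `H` commutes with `e^{-βH}`
(`Commute.exp_left`), so by cyclicity of the trace `tr(e^{-βH} U A Uᴴ) = tr(e^{-βH} A)`, i.e.
`⟨U A Uᴴ⟩_β = ⟨A⟩_β`. The junk side `L = 0` (both sides `0` by definition) is trivial.

## Sources

* F. J. Dyson, E. H. Lieb, B. Simon, *Phase transitions in quantum spin systems with isotropic and
  nonisotropic interactions*, J. Stat. Phys. 18 (1978) 335–383, §1, pp. 337–339, eqs. (2), (3Qb),
  (8), (9)/(9Q) (read in the reprint, E. H. Lieb, *Statistical Mechanics. Selecta*, pp. 147–152).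
* O. Bratteli, D. W. Robinson, *Operator Algebras and Quantum Statistical Mechanics II*, §5.3.1
  (Gibbs states), §6.2.1 (covariance of the local algebras).
* H. Tasaki, *Physics and Mathematics of Quantum Many-Body Systems* (2020), §2.4, App. A.

## Mathlib / Literature status

Reused: `siteSpin_submatrix_comp`, `spinBond_submatrix_comp`, `submatrix_finset_sum`,
`bijective_comp_equiv`, `Matrix.toPEquiv_toMatrix_conj`,
`Matrix.conjTranspose_toPEquiv_toMatrix_mul_self` (`XYOrderInfraredProofs`); Mathlib's
`Matrix.submatrix_mul`, `Finset.sum_nbij'`, `Sym2.map`, `Commute.exp_left`,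
`Matrix.trace_mul_cycle`. The invariance of the Gibbs state under a unitary commuting with `H`,
and under a reindexing fixing `H`, is proved here *privately*: the same two statements are proved
(publicly) in the barrier files
`Literature/Barriers/AtomisticToContinuum/HalfFillingDischarges.lean` and
`…/HalfFillingInfraredModes.lean` of another summit (`Matrix.gibbsState_conj_of_commute`,
`BoseGas.gibbsState_submatrix_of_invariant`), which this topic file does not import.
-/

noncomputable section

open Matrix Finset
open Literature.MathematicalPhysics.QuantumLattice Literature.Probability.LatticeModels

namespace Literature.MathematicalPhysics.QuantumLattice

/-! ### Symmetries of the Gibbs state -/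

section GibbsSymmetry

variable {m : Type*} [Fintype m] [DecidableEq m]

/-- Invariance of the Gibbs state under a symmetry: if `U` commutes with `H` and `UᴴU = 1` then
`⟨U A Uᴴ⟩_β = ⟨A⟩_β` (`e^{-βH}` commutes with `U`; cyclicity of the trace). Private copy of
`Matrix.gibbsState_conj_of_commute` (a barrier file of another summit, not imported here).
Bratteli–Robinson II §5.3.1. [folklore] -/
private theorem gibbsState_unitary_conj {H U : Matrix m m ℂ} (hU : U * H = H * U)
    (hUU : Uᴴ * U = 1) (β : ℝ) (A : Matrix m m ℂ) :
    gibbsState β H (U * A * Uᴴ) = gibbsState β H A := by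
  have hc : Commute (gibbsWeight β H) U := by
    have h1 : Commute (-(β : ℂ) • H) U := (Commute.smul_left (a := H) (b := U) hU.symm _)
    exact h1.exp_left
  rw [gibbsState_apply, gibbsState_apply]
  congr 1
  calc (gibbsWeight β H * (U * A * Uᴴ)).trace = (U * (gibbsWeight β H * A) * Uᴴ).trace := by
        rw [← Matrix.mul_assoc, ← Matrix.mul_assoc, hc.eq, Matrix.mul_assoc U]
    _ = (Uᴴ * U * (gibbsWeight β H * A)).trace := by
        rw [trace_mul_cycle, Matrix.mul_assoc]
    _ = (gibbsWeight β H * A).trace := by rw [hUU, Matrix.one_mul]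

/-- Invariance of the Gibbs state under a symmetry of the index set: if reindexing along the
permutation `e` fixes `H`, then `⟨O ∘ (e × e)⟩_{β,H} = ⟨O⟩_{β,H}` (the permutation matrix of `e`
is a unitary commuting with `H`). Private copy of
`Literature.Barriers.AtomisticToContinuum.BoseGas.gibbsState_submatrix_of_invariant` (a barrier
file of another summit, not imported here). Bratteli–Robinson II §5.3.1. [folklore] -/
private theorem gibbsState_submatrix_equiv_of_invariant {H : Matrix m m ℂ} (e : m ≃ m)
    (hinv : H.submatrix e e = H) (β : ℝ) (O : Matrix m m ℂ) :
    gibbsState β H (O.submatrix e e) = gibbsState β H O := by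
  set U : Matrix m m ℂ := e.toPEquiv.toMatrix with hU
  have hUU : Uᴴ * U = 1 := conjTranspose_toPEquiv_toMatrix_mul_self e
  have hcomm : U * H = H * U := by
    have h1 : U * H * Uᴴ = H := by rw [hU, toPEquiv_toMatrix_conj, hinv]
    calc U * H = U * H * (Uᴴ * U) := by rw [hUU, mul_one]
      _ = U * H * Uᴴ * U := by rw [← mul_assoc]
      _ = H * U := by rw [h1]
  rw [← toPEquiv_toMatrix_conj, ← hU]
  exact gibbsState_unitary_conj hcomm hUU β O

end GibbsSymmetry

/-! ### Covariance of the Heisenberg Hamiltonian under graph automorphisms -/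

section GraphAutomorphism

variable {Λ : Type*} [Fintype Λ] [DecidableEq Λ] (n : ℕ)

/-- Relabelling the exchange operators: `𝐒_x · 𝐒_y ↦ 𝐒_{π x} · 𝐒_{π y}` under the relabelling
`σ ↦ σ ∘ π` of tensor indices. Bratteli–Robinson II §6.2.1 (covariance). [folklore] -/
theorem spinDot_submatrix_comp (π : Λ ≃ Λ) (x y : Λ) :
    (spinDot n x y : Op Λ (n + 1)).submatrix (fun σ => σ ∘ π) (fun σ => σ ∘ π) =
      spinDot n (π x) (π y) := by
  simp only [spinDot, submatrix_finset_sum, spinBond_submatrix_comp]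

/-- Relabelling the edge terms: `spinDotSym n e ↦ spinDotSym n (Sym2.map π e)`. [folklore] -/
theorem spinDotSym_submatrix_comp (π : Λ ≃ Λ) (e : Sym2 Λ) :
    (spinDotSym n e : Op Λ (n + 1)).submatrix (fun σ => σ ∘ π) (fun σ => σ ∘ π) =
      spinDotSym n (Sym2.map π e) := by
  induction e using Sym2.ind with
  | h x y => rw [Sym2.map_mk, spinDotSym_mk, spinDotSym_mk, spinDot_submatrix_comp]

variable (G : SimpleGraph Λ) [DecidableRel G.Adj]

omit [Fintype Λ] [DecidableEq Λ] [DecidableRel G.Adj] in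
/-- A graph automorphism maps edges to edges. [folklore] -/
private theorem map_mem_edgeFinset_of_adj_iff (π : Λ ≃ Λ)
    (hπ : ∀ x y, G.Adj (π x) (π y) ↔ G.Adj x y) [Fintype G.edgeSet] {e : Sym2 Λ}
    (he : e ∈ G.edgeFinset) : Sym2.map π e ∈ G.edgeFinset := by
  induction e using Sym2.ind with
  | h x y =>
    rw [Sym2.map_mk, SimpleGraph.mem_edgeFinset, SimpleGraph.mem_edgeSet, hπ]
    exact (SimpleGraph.mem_edgeSet G).1 (SimpleGraph.mem_edgeFinset.1 he)

/-- **Covariance of the Heisenberg Hamiltonian.** Relabelling the sites along a graph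
automorphism `π` of a finite graph `G` fixes `H = J Σ_{{x,y} ∈ E(G)} 𝐒_x · 𝐒_y` (the edge sum
is reindexed along `Sym2.map π`); torus translations (`heisenbergTorus_submatrix_comp_addRight`)
and torus reflections are special cases. Bratteli–Robinson II §6.2.1 (covariance);
Tasaki (2020) §2.4. [folklore] -/
theorem heisenbergHamiltonian_submatrix_comp (J : ℝ) (π : Λ ≃ Λ)
    (hπ : ∀ x y, G.Adj (π x) (π y) ↔ G.Adj x y) :
    (heisenbergHamiltonian n G J).submatrix (fun σ => σ ∘ π) (fun σ => σ ∘ π) =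
      heisenbergHamiltonian n G J := by
  have hπ' : ∀ x y, G.Adj (π.symm x) (π.symm y) ↔ G.Adj x y := fun x y => by
    rw [← hπ (π.symm x) (π.symm y), Equiv.apply_symm_apply, Equiv.apply_symm_apply]
  unfold heisenbergHamiltonian
  simp only [submatrix_smul, Pi.smul_apply]
  rw [submatrix_finset_sum]
  congr 1
  refine Finset.sum_nbij' (Sym2.map π) (Sym2.map π.symm) (fun e he => ?_) (fun e he => ?_)
    (fun e _ => ?_) (fun e _ => ?_) (fun e _ => ?_)
  · exact map_mem_edgeFinset_of_adj_iff G π hπ he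
  · exact map_mem_edgeFinset_of_adj_iff G π.symm hπ' he
  · simp only [Sym2.map_map, Equiv.symm_comp_self, Sym2.map_id', id_eq]
  · simp only [Sym2.map_map, Equiv.self_comp_symm, Sym2.map_id', id_eq]
  · exact spinDotSym_submatrix_comp n π e

end GraphAutomorphism

/-! ### Translations of the torus: the Gibbs state and the discharge -/

section Torus

variable {d : ℕ}

/-- Translations are graph automorphisms of the discrete torus `(ℤ/Lℤ)^d` (private copy of
`Literature.Probability.LatticeModels.torusGraph_adj_add_right` of `IsingTransport.lean`, not
imported here). Friedli–Velenik (2017) §3.1. [folklore] -/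
private theorem torusGraph_adj_add_right_iff {L : ℕ} (v x y : TorusSite d L) :
    (torusGraph d L).Adj (x + v) (y + v) ↔ (torusGraph d L).Adj x y := by
  simp only [torusGraph_adj_iff, add_right_comm _ v, add_left_inj, ne_eq]

/-- Translation invariance of the Heisenberg Hamiltonian of the torus, as the special case
`π = (· + v)` of `heisenbergHamiltonian_submatrix_comp` (private: the public statement is
`heisenbergTorus_submatrix_comp_addRight` of `HeisenbergOrderTranslationProofs.lean`).
Dyson–Lieb–Simon (1978) §1, p. 337. [folklore] -/
private theorem heisenbergTorus_submatrix_comp_addRight_of_automorphism (L : ℕ) [NeZero L] (n : ℕ)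
    (J : ℝ) (v : TorusSite d L) :
    (heisenbergTorus d L n J).submatrix (fun σ => σ ∘ Equiv.addRight v)
        (fun σ => σ ∘ Equiv.addRight v) = heisenbergTorus d L n J :=
  heisenbergHamiltonian_submatrix_comp n (torusGraph d L) J (Equiv.addRight v)
    (fun x y => torusGraph_adj_add_right_iff v x y)

/-- **Translation invariance of the torus Gibbs state of the Heisenberg model**:
`⟨O ∘ (τ_v × τ_v)⟩_{β,L} = ⟨O⟩_{β,L}` for the relabelling `τ_v : σ ↦ σ ∘ (· + v)` of tensor indices
(a permutation unitary commuting with `H_L`). Dyson–Lieb–Simon (1978) §1, pp. 337–339;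
Bratteli–Robinson II §5.3.1. [folklore] -/
theorem gibbsState_heisenbergTorus_submatrix_comp_addRight (β : ℝ) (L : ℕ) [NeZero L] (n : ℕ)
    (J : ℝ) (v : TorusSite d L) (O : Op (TorusSite d L) (n + 1)) :
    gibbsState β (heisenbergTorus d L n J)
        (O.submatrix (fun σ => σ ∘ Equiv.addRight v) (fun σ => σ ∘ Equiv.addRight v)) =
      gibbsState β (heisenbergTorus d L n J) O :=
  gibbsState_submatrix_equiv_of_invariant
    (Equiv.arrowCongr (Equiv.addRight v).symm (Equiv.refl (Fin (n + 1))))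
    (heisenbergTorus_submatrix_comp_addRight_of_automorphism L n J v) β O

/-- Relabelling the spins along the translation `x ↦ x + v`: `S^α_{x+v} = S^α_x ∘ (τ_v × τ_v)`
(`siteSpin_submatrix_comp`). Bratteli–Robinson II §6.2.1 (covariance). [folklore] -/
theorem siteSpin_add_eq_submatrix (L : ℕ) [NeZero L] (n : ℕ) (v x : TorusSite d L) (α : Fin 3) :
    (siteSpin n (x + v) α : Op (TorusSite d L) (n + 1)) =
      (siteSpin n x α : Op (TorusSite d L) (n + 1)).submatrix (fun σ => σ ∘ Equiv.addRight v)
        (fun σ => σ ∘ Equiv.addRight v) :=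
  (siteSpin_submatrix_comp n (Equiv.addRight v) x α).symm

/-- **Discharge of `spinSpinCorrTorus_add_right`.** Translation invariance of the thermal
two-point function of the Heisenberg model on the torus:
`⟨𝐒_{x+v} · 𝐒_{y+v}⟩_{β,L} = ⟨𝐒_x · 𝐒_y⟩_{β,L}` for all `β`, `L`, `n`, `J`, `v`, `x`, `y` (for
`L ≠ 0`: `S^α_{x+v} S^α_{y+v}` is the relabelling of `S^α_x S^α_y` along `x ↦ x + v`, which fixes
`H_L`, and the Gibbs state is invariant under symmetries of `H_L`; for the junk side `L = 0` both
sides are `0`). Dyson–Lieb–Simon, J. Stat. Phys. 18 (1978) 335, §1, pp. 337–339: the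
Hamiltonian (2) "has periodic boundary conditions … `Λ`, viewed as a torus", thermal expectations
(3Qb), and the sum rule (9)/(9Q) `|Λ|⁻¹ Σ_p g_p = ⟨(𝐒_α)²⟩` "(any value of `α` can be used)", i.e.
the translation invariance of the periodic Gibbs state used throughout.
[cite: DysonLiebSimon1978, §1, pp. 337–339, eqs. (2), (3Qb), (9Q)] -/
theorem spinSpinCorrTorus_add_right_holds : spinSpinCorrTorus_add_right (d := d) := by
  intro β L n J v x y
  rcases Nat.eq_zero_or_pos L with hL | hL
  · subst hL
    simp
  · haveI : NeZero L := ⟨hL.ne'⟩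
    rw [spinSpinCorrTorus_of_neZero, spinSpinCorrTorus_of_neZero]
    refine congrArg Complex.re (Finset.sum_congr rfl fun α _ => ?_)
    rw [thermalCorr, thermalCorr, siteSpin_add_eq_submatrix L n v x α,
      siteSpin_add_eq_submatrix L n v y α,
      ← Matrix.submatrix_mul _ _ _ _ _ (bijective_comp_equiv (q := n + 1) _),
      gibbsState_heisenbergTorus_submatrix_comp_addRight]

end Torus

end Literature.MathematicalPhysics.QuantumLattice
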